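import Mathlib.MeasureTheory.Integral.IntervalIntegral.FundThmCalculus
import Mathlib.Analysis.SpecialFunctions.Trigonometric.ArctanDeriv

/-!
# `StokesGeneration` (stmt-KontsevichZagierPeriods-3586) — line `fibrewise_stokes`, stub `stub_saArctanFTC`

Registered rung stub X6 (rung 10) of the line `fibrewise_stokes` of the crux `StokesGeneration`
(route UnfoldedStokes): **the one-piece fundamental theorem of calculus for the phase of a `C¹`
loop in the right half-plane**.

Rung 10 (angular sector of a semialgebraic `C¹` loop) cuts a zero-free loop into pieces; on a
piece `[a, b]` the re-centred loop is `U + iW` with `U`, `W` continuous on `[a, b]`, differentiable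
on `(a, b)` with derivatives `U'`, `W'` that extend continuously to `[a, b]`, and `U > 0` on
`[a, b]`. The phase increment of the piece is
`arctan (W/U)|ₐᵇ = ∫ₐᵇ (U W' − U' W)/(U² + W²)`.

Proof: `F u = arctan (W u / U u)` is continuous on `[a, b]` (`U ≠ 0` there) and has derivative
`(1/(1 + (W/U)²)) · (W' U − W U')/U² = (U W' − U' W)/(U² + W²)` at every interior point
(chain rule for `arctan` and the quotient rule); the integrand is continuous on `[a, b]` since
`U² + W² ≥ U² > 0`, hence interval integrable, and
`intervalIntegral.integral_eq_sub_of_hasDerivAt_of_le` concludes.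

This is the function-level transposition of the polynomial statement `stub_rungArctanFTC`
(rung 4, `UnfoldedStokesStokesGenerationStubRungArctanFTC`).

References: M. Kontsevich, D. Zagier, *Periods* (2001), §1.2 (Stokes/FTC among the three rules);
the computation itself is folklore calculus.
-/

noncomputable section

-- `Summit.KontsevichZagierPeriods.KontsevichZagierPeriods.…` is the tree's mandated layout (single-conjunct summit).
set_option linter.dupNamespace false

namespace Summit.KontsevichZagierPeriods.KontsevichZagierPeriods.Cruxes.StokesGeneration.FibrewiseStokes

open MeasureTheory Set

/-- Derivative of the phase `u ↦ arctan (W u / U u)` of the loop `U + iW` at a point `s` with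
`U s ≠ 0`, where `U`, `W` have derivatives `U's`, `W's` at `s`: it is
`(U W' − U' W)/(U² + W²)` evaluated at `s` (chain rule for `arctan`, quotient rule, and
`1 + (W/U)² = (U² + W²)/U²`). [folklore] -/
theorem saArctan_hasDerivAt {U W : ℝ → ℝ} {U's W's s : ℝ}
    (hU : HasDerivAt U U's s) (hW : HasDerivAt W W's s) (hU0 : U s ≠ 0) :
    HasDerivAt (fun u => Real.arctan (W u / U u))
      ((U s * W's - U's * W s) / (U s ^ 2 + W s ^ 2)) s := by
  have hq : HasDerivAt (fun u => W u / U u) ((W's * U s - W s * U's) / U s ^ 2) s :=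
    hW.div hU hU0
  refine hq.arctan.congr_deriv ?_
  have hE : U s ^ 2 + W s ^ 2 ≠ 0 := by
    have h1 : 0 < U s ^ 2 := by positivity
    have h2 : 0 ≤ W s ^ 2 := sq_nonneg _
    exact ne_of_gt (by linarith)
  field_simp

/-- Continuity of the phase `u ↦ arctan (W u / U u)` on a set where `U`, `W` are continuous and
`U` does not vanish. [folklore] -/
theorem saArctan_continuousOn {U W : ℝ → ℝ} {t : Set ℝ}
    (hUc : ContinuousOn U t) (hWc : ContinuousOn W t) (hU : ∀ u ∈ t, U u ≠ 0) :
    ContinuousOn (fun u => Real.arctan (W u / U u)) t :=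
  Real.continuous_arctan.comp_continuousOn (hWc.div hUc hU)

/-- Continuity of the angular integrand `(U W' − U' W)/(U² + W²)` on a set where `U`, `W`, `U'`,
`W'` are continuous and `U` does not vanish (the denominator is `≥ U² > 0`). [folklore] -/
theorem saArctan_integrand_continuousOn {U W U' W' : ℝ → ℝ} {t : Set ℝ}
    (hUc : ContinuousOn U t) (hWc : ContinuousOn W t)
    (hU'c : ContinuousOn U' t) (hW'c : ContinuousOn W' t) (hU : ∀ u ∈ t, U u ≠ 0) :
    ContinuousOn (fun u => (U u * W' u - U' u * W u) / (U u ^ 2 + W u ^ 2)) t := by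
  refine ContinuousOn.div ?_ ?_ ?_
  · exact (hUc.mul hW'c).sub (hU'c.mul hWc)
  · exact (hUc.pow 2).add (hWc.pow 2)
  · intro u hu
    have h1 : 0 < U u ^ 2 := by
      have := hU u hu
      positivity
    have h2 : 0 ≤ W u ^ 2 := sq_nonneg _
    exact ne_of_gt (by linarith)

/-- **Registered stub `stub_saArctanFTC` (X6, rung 10 of the line `fibrewise_stokes`).**
For real functions `U`, `W` continuous on `[a, b]` (`a ≤ b`), with derivatives `U'`, `W'` on
`(a, b)` that are continuous on `[a, b]`, and with `U > 0` on `[a, b]`, the phase increment of the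
loop piece `U + iW` over `[a, b]` is the integral of its angular derivative:
`arctan (W b/U b) − arctan (W a/U a) = ∫ₐᵇ (U W' − U' W)/(U² + W²)`.
Fundamental theorem of calculus (`intervalIntegral.integral_eq_sub_of_hasDerivAt_of_le`) for
`F = arctan (W/U)`, continuous on `[a, b]` with the stated (continuous, hence interval-integrable)
derivative on `(a, b)`. [folklore] [cite: KontsevichZagier2001, §1.2] -/
theorem stub_saArctanFTC :
    ∀ (U W U' W' : ℝ → ℝ) (a b : ℝ), a ≤ b →
      ContinuousOn U (Set.Icc a b) → ContinuousOn W (Set.Icc a b) →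
      ContinuousOn U' (Set.Icc a b) → ContinuousOn W' (Set.Icc a b) →
      (∀ u ∈ Set.Ioo a b, HasDerivAt U (U' u) u) → (∀ u ∈ Set.Ioo a b, HasDerivAt W (W' u) u) →
      (∀ u ∈ Set.Icc a b, 0 < U u) →
      Real.arctan (W b / U b) - Real.arctan (W a / U a) =
        ∫ u in a..b, (U u * W' u - U' u * W u) / (U u ^ 2 + W u ^ 2) := by
  intro U W U' W' a b hab hUc hWc hU'c hW'c hUd hWd hpos
  have hU : ∀ u ∈ Set.Icc a b, U u ≠ 0 := fun u hu => (hpos u hu).ne'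
  symm
  refine intervalIntegral.integral_eq_sub_of_hasDerivAt_of_le
    (f := fun u => Real.arctan (W u / U u)) hab
    (saArctan_continuousOn hUc hWc hU)
    (fun x hx => saArctan_hasDerivAt (hUd x hx) (hWd x hx) (hU x (Ioo_subset_Icc_self hx))) ?_
  exact (saArctan_integrand_continuousOn hUc hWc hU'c hW'c hU).intervalIntegrable_of_Icc hab

end Summit.KontsevichZagierPeriods.KontsevichZagierPeriods.Cruxes.StokesGeneration.FibrewiseStokes
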